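import Summits.HodgeConjecture.CorCM.HypLiu418.RecordSystemOfDescent
import HarnessLib

/-!
# Change of frame for Deligne's record systems between two ARBITRARY Sylvester frames `T`, `T'` of `H^τ` — SAME models, AS DATA

Cell `hodgecm-mathlib`, fan A, off-place half of `HLiu418` (director g2 2026-08-28T04:36:01Z: A-p08 = lead of the END (4)/(5)/(B)(ii); plan v1
FILE A1).  ✔ `RecordSystemFrameChange.lean` re-reads a record system at `(τ, T)` in the frame `T·u`, `u ∈ U(2,1)`; the END needs the target frame to be
a GIVEN second frame `T'` (the chosen frame `frameOf V₀` of the other CHOSEN record) LITERALLY, not as `T·u` up to a propositional equality (the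
record's type depends on the frame).  Here `u := frameRatio T T' = T⁻¹ T' ∈ U(J)` is defined from the two frames and every statement is made at `T'`
itself: `T'⁻¹ γ^τ T' = u⁻¹ (T⁻¹ γ^τ T) u` holds on the nose.

* §1 `frameRatio`, `ratToU21_ofFrames`, `shimuraSetOfFrames : Sh_K(ℂ)_{T'} ≃ₜ Sh_K(ℂ)_T`, `[y, a] ↦ [u • y, a]` (`rfl` formulas),
  `frame_mulVec_lift_ofFrames : T'·(y,1) = (u·(y,1))₃ • T·(u•y,1)`, `isLinePoint_ofFrames_iff`;
* §2 `ComplexRecordSystem.toFrame Sc T' hT'` (Mc := Sc.Mc) with its point formula by `rfl`;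
* §3 `recip_toFrame`, **`RecordSystem.toFrame R T' hT'`** := ✔ `RecordSystem.ofDescent` (same models `R.M`, `rfl`) with the point formula
  `((R.toFrame T' hT').pts K)⁻¹ [y, aK]_{T'} = (R.pts K)⁻¹ [u • y, aK]_T`, and the ∃-form `RecordSystem.exists_toFrame`.

KERNEL: definitions by explicit formula + theorems; no instance, no notation, no named fact, no `sorry`.  HC_CM is NOT proved here; HC_CM is proved
only modulo the 7 printed citations until rung 0 closes.

References: [Deligne1979ShimuraVarieties] 2.1.2–2.1.4, 2.2.5; [Milne2005ShimuraVarieties] Lemma 5.13 p. 57, Def. 12.5 p. 113, Def. 12.8 (62) p. 114, §12.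
-/

set_option autoImplicit false

noncomputable section

open CategoryTheory AlgebraicGeometry NumberField IsDedekindDomain Matrix
open Literature.AlgebraicGeometry.Motives
open Literature.NumberTheory.Automorphic.Liu2021.AppendixC (C5.OpenCompactSubgroup C5.SmallLevel)

namespace Summit.HodgeConjecture.CorCM.Model.RecordSystemConj

open Limits Function MulAction Topology
open scoped Matrix
open Literature.AlgebraicGeometry.ShimuraVarieties Literature.AlgebraicGeometry.ShimuraVarieties.UnitaryCanonicalModel
open Literature.NumberTheory.Automorphic Literature.NumberTheory.Automorphic.UnitaryGroup
open Literature.NumberTheory.Automorphic.ShimuraDissection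
open Literature.Geometry.ComplexHyperbolic Literature.Geometry.ComplexHyperbolic.BallModel

/-! ## §1 Two frames and the Shimura set: `[y, a]_{T'} ↦ [u • y, a]_T`, `u = T⁻¹T'` -/

section TwoFrames

variable (L : Type) [Field L] (H : Matrix (Fin 3) (Fin 3) L) (τ : L →+* ℂ) (T T' : GL (Fin 3) ℂ)
  (hT : formCongr (starRingEnd ℂ) T (H.map τ) = BallModel.J) (hT' : formCongr (starRingEnd ℂ) T' (H.map τ) = BallModel.J)

include hT hT'

/-- `(T⁻¹T')ᴴ J (T⁻¹T') = J` for two frames `T`, `T'` of `H^τ` (`J = Tᴴ H^τ T`, `T'ᴴ H^τ T' = J`). [folklore] -/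
theorem conjTranspose_frameQuot_mul_mul :
    (((T⁻¹ * T' : GL (Fin 3) ℂ)) : Matrix (Fin 3) (Fin 3) ℂ)ᴴ * BallModel.J * (((T⁻¹ * T' : GL (Fin 3) ℂ)) : Matrix (Fin 3) (Fin 3) ℂ) =
      BallModel.J := by
  have h1 : formCongr (starRingEnd ℂ) (T⁻¹ * T') (formCongr (starRingEnd ℂ) T (H.map τ)) = BallModel.J := by
    have hT'' := hT'
    rw [formCongr_star] at hT''
    rw [formCongr_star, formCongr_star, Units.val_mul, Matrix.conjTranspose_mul]
    calc ((T' : GL (Fin 3) ℂ) : Matrix (Fin 3) (Fin 3) ℂ)ᴴ * ((T⁻¹ : GL (Fin 3) ℂ) : Matrix (Fin 3) (Fin 3) ℂ)ᴴ *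
          ((T : Matrix (Fin 3) (Fin 3) ℂ)ᴴ * H.map τ * (T : Matrix (Fin 3) (Fin 3) ℂ)) *
          (((T⁻¹ : GL (Fin 3) ℂ) : Matrix (Fin 3) (Fin 3) ℂ) * (T' : Matrix (Fin 3) (Fin 3) ℂ))
        = (T' : Matrix (Fin 3) (Fin 3) ℂ)ᴴ *
            ((((T⁻¹ : GL (Fin 3) ℂ) : Matrix (Fin 3) (Fin 3) ℂ)ᴴ * (T : Matrix (Fin 3) (Fin 3) ℂ)ᴴ) * H.map τ *
              ((T : Matrix (Fin 3) (Fin 3) ℂ) * ((T⁻¹ : GL (Fin 3) ℂ) : Matrix (Fin 3) (Fin 3) ℂ))) *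
            (T' : Matrix (Fin 3) (Fin 3) ℂ) := by
          simp only [Matrix.mul_assoc]
      _ = BallModel.J := by
          rw [← Matrix.conjTranspose_mul, ← Units.val_mul, mul_inv_cancel, Units.val_one, Matrix.conjTranspose_one,
            Matrix.one_mul, Matrix.mul_one]
          exact hT''
  rw [hT, formCongr_star] at h1
  exact h1

/-- **The frame ratio `u := T⁻¹ T' ∈ U(J) = U(2,1)`** of two frames of `H^τ`. [folklore] -/
def frameRatio : U21 :=
  mkU21 _ (conjTranspose_frameQuot_mul_mul L H τ T T' hT hT')

/-- `frameRatio T T' = T⁻¹ T'` in `GL₃(ℂ)`. [folklore] -/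
theorem coe_frameRatio : ((frameRatio L H τ T T' hT hT' : U21) : GL (Fin 3) ℂ) = T⁻¹ * T' :=
  Units.ext rfl

/-- `T · frameRatio T T' = T'`. [folklore] -/
theorem mul_frameRatio : T * ((frameRatio L H τ T T' hT hT' : U21) : GL (Fin 3) ℂ) = T' := by
  rw [coe_frameRatio, mul_inv_cancel_left]

variable [NumberField L] [IsCMField L]

/-- **`T'⁻¹ γ^τ T' = u⁻¹ (T⁻¹ γ^τ T) u`** with `u = T⁻¹ T'`: the archimedean projections of `U(H)(L⁺)` in the two frames are `u`-conjugate.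
[folklore] -/
theorem ratToU21_ofFrames (γ : rational (↥(maximalRealSubfield L)) L (IsCMField.complexConj L) 3 H) :
    ratToU21 L H τ T' hT' γ =
      (frameRatio L H τ T T' hT hT')⁻¹ * ratToU21 L H τ T hT γ * frameRatio L H τ T T' hT hT' := by
  apply Subtype.ext
  change ((archProjU21EmbCM L H τ T' hT'
      (rationalToArch (↥(maximalRealSubfield L)) L (IsCMField.complexConj L) 3 H γ) : U21) : GL (Fin 3) ℂ) =
    ((frameRatio L H τ T T' hT hT' : U21) : GL (Fin 3) ℂ)⁻¹ * ((archProjU21EmbCM L H τ T hT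
      (rationalToArch (↥(maximalRealSubfield L)) L (IsCMField.complexConj L) 3 H γ) : U21) : GL (Fin 3) ℂ) *
      ((frameRatio L H τ T T' hT hT' : U21) : GL (Fin 3) ℂ)
  rw [coe_archProjU21EmbCM_rationalToArch, coe_archProjU21EmbCM_rationalToArch, coe_frameRatio, _root_.mul_inv_rev, inv_inv]
  simp only [mul_assoc, mul_inv_cancel_left]

/-- **Equivariance of `y ↦ u • y`** between the `U(H)(L⁺)`-ball in the frame `T'` and in the frame `T`. [folklore] -/
theorem smul_ratToU21_ofFrames_smul (γ : rational (↥(maximalRealSubfield L)) L (IsCMField.complexConj L) 3 H) (y : Ball) :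
    frameRatio L H τ T T' hT hT' • (ratToU21 L H τ T' hT' γ • y) = ratToU21 L H τ T hT γ • (frameRatio L H τ T T' hT hT' • y) := by
  rw [ratToU21_ofFrames L H τ T T' hT hT', smul_smul, smul_smul, ← mul_assoc, ← mul_assoc, mul_inv_cancel, one_mul]

/-- The ball factor `y ↦ u • y` between the `U(H)(L⁺)`-ball in the frame `T'` and in the frame `T`. [folklore] -/
def ballFactorOfFrames : Through (ratToU21 L H τ T' hT') Ball ≃ₜ Through (ratToU21 L H τ T hT) Ball :=
  ((Through.mkHomeomorph (ratToU21 L H τ T' hT') Ball).symm.trans (Homeomorph.smul (frameRatio L H τ T T' hT hT'))).trans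
    (Through.mkHomeomorph (ratToU21 L H τ T hT) Ball)

variable (K : Subgroup ↥(finAdelic (↥(maximalRealSubfield L)) L (IsCMField.complexConj L) 3 H))

/-- The product map `(y, aK) ↦ (u • y, aK)`. [folklore] -/
def pairOfFrames :
    Through (ratToU21 L H τ T' hT') Ball × CosetSpace (rationalToFinAdelic (↥(maximalRealSubfield L)) L (IsCMField.complexConj L) 3 H) K ≃ₜ
      Through (ratToU21 L H τ T hT) Ball × CosetSpace (rationalToFinAdelic (↥(maximalRealSubfield L)) L (IsCMField.complexConj L) 3 H) K :=
  (ballFactorOfFrames L H τ T T' hT hT').prodCongr (Homeomorph.refl _)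

/-- **Equivariance of `(y, aK) ↦ (u • y, aK)`** under `U(H)(L⁺)`. [folklore] -/
theorem pairOfFrames_smul (γ : rational (↥(maximalRealSubfield L)) L (IsCMField.complexConj L) 3 H)
    (p : Through (ratToU21 L H τ T' hT') Ball ×
      CosetSpace (rationalToFinAdelic (↥(maximalRealSubfield L)) L (IsCMField.complexConj L) 3 H) K) :
    pairOfFrames L H τ T T' hT hT' K (γ • p) = (MulEquiv.refl _) γ • pairOfFrames L H τ T T' hT hT' K p := by
  obtain ⟨z, y⟩ := p
  rw [Prod.smul_mk, MulEquiv.refl_apply, Prod.smul_mk]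
  refine Prod.ext ?_ rfl
  change Through.mk _ Ball (frameRatio L H τ T T' hT hT' • (ratToU21 L H τ T' hT' γ • (Through.mk (ratToU21 L H τ T' hT') Ball).symm z)) =
    γ • Through.mk _ Ball (frameRatio L H τ T T' hT hT' • (Through.mk (ratToU21 L H τ T' hT') Ball).symm z)
  rw [Through.smul_mk, smul_ratToU21_ofFrames_smul]

/-- **The Shimura set in two frames**: `Sh_K(U(H), 𝔹²)(ℂ)` presented in the frame `T'` and in the frame `T` are homeomorphic by `[y, aK] ↦ [u • y, aK]`,
`u = T⁻¹T'` (same group, same level). [cite: Milne2005ShimuraVarieties, Lemma 5.13 p. 57] -/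
def shimuraSetOfFrames : ShimuraSet L H τ T' hT' K ≃ₜ ShimuraSet L H τ T hT K :=
  orbitQuotientHomeomorphOfEquivariant (MulEquiv.refl _) (pairOfFrames L H τ T T' hT hT' K) (pairOfFrames_smul L H τ T T' hT hT' K)

/-- `shimuraSetOfFrames [y, aK] = [u • y, aK]`. [cite: Milne2005ShimuraVarieties, Lemma 5.13 p. 57] -/
@[simp] theorem shimuraSetOfFrames_mk (y : Ball) (a : ↥(finAdelic (↥(maximalRealSubfield L)) L (IsCMField.complexConj L) 3 H)) :
    shimuraSetOfFrames L H τ T T' hT hT' K (ShimuraSet.mk L H τ T' hT' K y a) =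
      ShimuraSet.mk L H τ T hT K (frameRatio L H τ T T' hT hT' • y) a :=
  rfl

/-- `shimuraSetOfFrames⁻¹ [x, aK] = [u⁻¹ • x, aK]`. [cite: Milne2005ShimuraVarieties, Lemma 5.13 p. 57] -/
@[simp] theorem shimuraSetOfFrames_symm_mk (x : Ball) (a : ↥(finAdelic (↥(maximalRealSubfield L)) L (IsCMField.complexConj L) 3 H)) :
    (shimuraSetOfFrames L H τ T T' hT hT' K).symm (ShimuraSet.mk L H τ T hT K x a) =
      ShimuraSet.mk L H τ T' hT' K ((frameRatio L H τ T T' hT hT')⁻¹ • x) a :=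
  rfl

omit [NumberField L] [IsCMField L] in
/-- **Frame vectors in two frames**: `T'·(y,1) = (u·(y,1))₃ • T·(u • y, 1)`, a NON-ZERO multiple of the `T`-frame vector of `u • y` (✔ `lift_act`).
[folklore] -/
theorem frame_mulVec_lift_ofFrames (y : Ball) :
    (T' : Matrix (Fin 3) (Fin 3) ℂ) *ᵥ BallModel.lift y =
      W3 (frameRatio L H τ T T' hT hT') y 2 • ((T : Matrix (Fin 3) (Fin 3) ℂ) *ᵥ BallModel.lift (frameRatio L H τ T T' hT hT' • y)) := by
  rw [← frame_mul_mulVec_lift T (frameRatio L H τ T T' hT hT') y, mul_frameRatio]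

omit [NumberField L] [IsCMField L] in
/-- **Special points in two frames**: `y` is a line point of `v₃` in the frame `T'` iff `u • y` is one in the frame `T`.
[cite: Milne2005ShimuraVarieties, Def. 12.5 and Rem. 12.6 p. 113] -/
theorem isLinePoint_ofFrames_iff (v₃ : Fin 3 → L) (y : Ball) :
    IsLinePoint L τ T' v₃ y ↔ IsLinePoint L τ T v₃ (frameRatio L H τ T T' hT hT' • y) := by
  rw [← isLinePoint_frameChange_iff L τ T (frameRatio L H τ T T' hT hT') v₃ y, mul_frameRatio]

end TwoFrames

/-! ## §2 The complex record system moved to the frame `T'`: SAME complex models -/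

section ComplexToFrame

variable {L : Type} [Field L] [NumberField L] [IsCMField L] {H : Matrix (Fin 3) (Fin 3) L}
  {τ : L →+* ℂ} {T : GL (Fin 3) ℂ} {hT : formCongr (starRingEnd ℂ) T (H.map τ) = BallModel.J}
  {K₀ : C5.OpenCompactSubgroup ↥(finAdelic (↥(maximalRealSubfield L)) L (IsCMField.complexConj L) 3 H)}
  (T' : GL (Fin 3) ℂ) (hT' : formCongr (starRingEnd ℂ) T' (H.map τ) = BallModel.J)

/-- The points identification in the frame `T'`: `Mc_K(ℂ) ≃ₜ Sh_K(ℂ)_T ≃ₜ Sh_K(ℂ)_{T'}` (`Sc.pts K`, then `[x, a] ↦ [u⁻¹ • x, a]`).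
[cite: Milne2005ShimuraVarieties, Lemma 5.13 p. 57] -/
def toFramePts (Sc : ComplexRecordSystem L H τ T hT K₀) (K : C5.SmallLevel K₀) :
    ComplexPoints (Sc.Mc.obj K) ≃ₜ ShimuraSet L H τ T' hT' K.1.1 :=
  (Sc.pts K).trans (shimuraSetOfFrames L H τ T T' hT hT' K.1.1).symm

/-- **Point formula, by `rfl`**: `(toFramePts)⁻¹ [y, aK]_{T'} = (Sc.pts K)⁻¹ [u • y, aK]_T`. [cite: Milne2005ShimuraVarieties, Lemma 5.13 p. 57] -/
theorem toFramePts_symm_mk (Sc : ComplexRecordSystem L H τ T hT K₀) (K : C5.SmallLevel K₀) (y : Ball)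
    (a : finAdelic (↥(maximalRealSubfield L)) L (IsCMField.complexConj L) 3 H) :
    (toFramePts T' hT' Sc K).symm (ShimuraSet.mk L H τ T' hT' K.1.1 y a) =
      (Sc.pts K).symm (ShimuraSet.mk L H τ T hT K.1.1 (frameRatio L H τ T T' hT hT' • y) a) :=
  rfl

/-- `toFramePts P = [u⁻¹ • x, aK]` when `Sc.pts K P = [x, aK]` (unfolding). [cite: Milne2005ShimuraVarieties, Lemma 5.13 p. 57] -/
theorem toFramePts_apply (Sc : ComplexRecordSystem L H τ T hT K₀) (K : C5.SmallLevel K₀) (P : ComplexPoints (Sc.Mc.obj K)) :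
    toFramePts T' hT' Sc K P = (shimuraSetOfFrames L H τ T T' hT hT' K.1.1).symm (Sc.pts K P) :=
  rfl

/-- (C2a) in the frame `T'`: the transitions act as `[y, aK₁] ↦ [y, aK₂]`. [cite: Deligne1979ShimuraVarieties, 2.1.4] -/
theorem toFramePts_map_pts (Sc : ComplexRecordSystem L H τ T hT K₀) (K₁ K₂ : C5.SmallLevel K₀) (f : K₁ ⟶ K₂) (y : Ball)
    (a : finAdelic (↥(maximalRealSubfield L)) L (IsCMField.complexConj L) 3 H) :
    toFramePts T' hT' Sc K₂ (AlgPoints.map (Sc.Mc.map f) ((toFramePts T' hT' Sc K₁).symm (ShimuraSet.mk L H τ T' hT' K₁.1.1 y a))) =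
      ShimuraSet.mk L H τ T' hT' K₂.1.1 y a := by
  rw [toFramePts_symm_mk, toFramePts_apply, Sc.map_pts, shimuraSetOfFrames_symm_mk, inv_smul_smul]

/-- (C2b) in the frame `T'`: the `hol` witness of `Sc` at `(K, a)` serves verbatim (its own homogeneity absorbs the scalar `(u·(y,1))₃ ≠ 0`).
[cite: SerreGAGA1956, §2] [cite: Deligne1979ShimuraVarieties, 2.1.2–2.1.4] -/
theorem hol_toFrame (Sc : ComplexRecordSystem L H τ T hT K₀) (K : C5.SmallLevel K₀)
    (a : finAdelic (↥(maximalRealSubfield L)) L (IsCMField.complexConj L) 3 H) :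
    ∃ w : (Fin 3 → ℂ) → ComplexPoints (Sc.Mc.obj K),
      (∀ y : Ball, w ((T' : Matrix (Fin 3) (Fin 3) ℂ) *ᵥ BallModel.lift y) =
          (toFramePts T' hT' Sc K).symm (ShimuraSet.mk L H τ T' hT' K.1.1 y a)) ∧
      (∀ v ∈ negCone (H.map τ), ∀ c : ℂ, c ≠ 0 → w (c • v) = w v) ∧
      ∀ (U : (Sc.Mc.obj K).left.affineOpens) (f : (Sc.Mc.obj K).left.presheaf.obj (Opposite.op (↑U : (Sc.Mc.obj K).left.Opens))),
        DifferentiableOn ℂ (fun v ↦ AlgPoints.evalOrZero (↑U : (Sc.Mc.obj K).left.Opens) f (w v))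
          (negCone (H.map τ) ∩ w ⁻¹' {P | P.pt ∈ (↑U : (Sc.Mc.obj K).left.Opens)}) := by
  obtain ⟨w, h1, h2, h3⟩ := Sc.hol K a
  refine ⟨w, fun y => ?_, h2, h3⟩
  rw [frame_mulVec_lift_ofFrames L H τ T T' hT hT', h2 _ (frame_mulVec_lift_mem_negCone hT _) _ (W3_2_ne_zero _ y), h1,
    toFramePts_symm_mk]

/-- (C2c) in the frame `T'`: the pieces of `Sc` at `K` serve verbatim (same cofan, ball data, representatives), the uniformisation clause at
`T'·(y,1) = c • T·(u•y,1)` by ✔ `unif_smul`. [cite: Deligne1979ShimuraVarieties, 2.1.2] [cite: Milne2005ShimuraVarieties, Lemma 5.13 p. 57] -/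
theorem pieces_toFrame (Sc : ComplexRecordSystem L H τ T hT K₀) (K : C5.SmallLevel K₀) :
    ∃ (g : orbitRel.Quotient (rational (↥(maximalRealSubfield L)) L (IsCMField.complexConj L) 3 H)
          (CosetSpace (rationalToFinAdelic (↥(maximalRealSubfield L)) L (IsCMField.complexConj L) 3 H) K.1.1) →
        finAdelic (↥(maximalRealSubfield L)) L (IsCMField.complexConj L) 3 H)
      (_ : ∀ q, Quotient.mk'' (CosetSpace.pt (rationalToFinAdelic _ L _ 3 H) K.1.1 (g q)) = q)
      (X : orbitRel.Quotient (rational (↥(maximalRealSubfield L)) L (IsCMField.complexConj L) 3 H)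
          (CosetSpace (rationalToFinAdelic (↥(maximalRealSubfield L)) L (IsCMField.complexConj L) 3 H) K.1.1) →
        SchemeOver ℂ)
      (ι : ∀ q, X q ⟶ Sc.Mc.obj K)
      (_ : IsColimit (Cofan.mk (Sc.Mc.obj K) ι))
      (B : ∀ q, UnitaryBallUniformisationDatum 2 (X q)),
      ∀ q, (B q).Hℂ = H.map τ ∧
        (B q).Γ.map (Matrix.GeneralLinearGroup.map ((B q).τ₁ : ↥(B q).E →+* ℂ)) =
          (arithmeticLevel (↥(maximalRealSubfield L)) L (IsCMField.complexConj L) 3 H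
            (K.1.1.map (MulAut.conj (g q)).toMonoidHom)).map (Matrix.GeneralLinearGroup.map τ) ∧
        ∀ y : Ball, AlgPoints.map (ι q) ((B q).unif ((T' : Matrix (Fin 3) (Fin 3) ℂ) *ᵥ BallModel.lift y)) =
          (toFramePts T' hT' Sc K).symm (ShimuraSet.mk L H τ T' hT' K.1.1 y (g q)) := by
  obtain ⟨g, hg, X, ι, hcol, B, hB⟩ := Sc.pieces K
  refine ⟨g, hg, X, ι, hcol, B, fun q => ⟨(hB q).1, (hB q).2.1, fun y => ?_⟩⟩
  have hcone : (T : Matrix (Fin 3) (Fin 3) ℂ) *ᵥ BallModel.lift (frameRatio L H τ T T' hT hT' • y) ∈ (B q).cone := by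
    change _ ∈ negCone (B q).Hℂ
    rw [(hB q).1]
    exact frame_mulVec_lift_mem_negCone hT _
  rw [frame_mulVec_lift_ofFrames L H τ T T' hT hT', (B q).unif_smul (W3_2_ne_zero _ y) hcone, (hB q).2.2, toFramePts_symm_mk]

/-- **The complex record system IN THE FRAME `T'`**, as a structure literal (SAME complex models `Sc.Mc`).
[cite: Deligne1979ShimuraVarieties, 2.1.2–2.1.4 (PDF p. 24 of Milne's translation)] [cite: Milne2005ShimuraVarieties, Lemma 5.13 p. 57] -/
def ComplexRecordSystem.toFrame (Sc : ComplexRecordSystem L H τ T hT K₀) : ComplexRecordSystem L H τ T' hT' K₀ where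
  Mc := Sc.Mc
  smooth := Sc.smooth
  projective := Sc.projective
  pts := toFramePts T' hT' Sc
  map_pts := toFramePts_map_pts T' hT' Sc
  hol := hol_toFrame T' hT' Sc
  pieces := pieces_toFrame T' hT' Sc

/-- The models of `Sc.toFrame T' hT'` are those of `Sc` (by `rfl`). [folklore] -/
theorem ComplexRecordSystem.toFrame_Mc (Sc : ComplexRecordSystem L H τ T hT K₀) :
    (ComplexRecordSystem.toFrame T' hT' Sc).Mc = Sc.Mc :=
  rfl

/-- **Point formula for `Sc.toFrame T' hT'`** (by `rfl`): `((Sc.toFrame T' hT').pts K)⁻¹ [y, aK]_{T'} = (Sc.pts K)⁻¹ [u • y, aK]_T`.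
[cite: Milne2005ShimuraVarieties, Lemma 5.13 p. 57] -/
theorem ComplexRecordSystem.toFrame_pts_symm_mk (Sc : ComplexRecordSystem L H τ T hT K₀) (K : C5.SmallLevel K₀) (y : Ball)
    (a : finAdelic (↥(maximalRealSubfield L)) L (IsCMField.complexConj L) 3 H) :
    ((ComplexRecordSystem.toFrame T' hT' Sc).pts K).symm (ShimuraSet.mk L H τ T' hT' K.1.1 y a) =
      (Sc.pts K).symm (ShimuraSet.mk L H τ T hT K.1.1 (frameRatio L H τ T T' hT hT' • y) a) :=
  rfl

/-- **Point formula for the complex shadow of a record system `R` moved to the frame `T'`**, with the record's own `pts` and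
`AlgPoints.baseChangeEquiv τ`: `(… pts K)⁻¹ [y, aK]_{T'} = ((R.pts K)⁻¹ [u • y, aK]_T)_τ`. [cite: Deligne1979ShimuraVarieties, 2.2.5] -/
theorem ComplexRecordSystem.toFrame_pts_symm_mk_record (R : RecordSystem L H τ T hT K₀) (K : C5.SmallLevel K₀) (y : Ball)
    (a : finAdelic (↥(maximalRealSubfield L)) L (IsCMField.complexConj L) 3 H) :
    letI : Algebra L ℂ := τ.toAlgebra
    ((ComplexRecordSystem.toFrame T' hT' R.complexRecordSystem).pts K).symm (ShimuraSet.mk L H τ T' hT' K.1.1 y a) =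
      AlgPoints.baseChangeEquiv τ (R.M.obj K) ((R.pts K).symm (ShimuraSet.mk L H τ T hT K.1.1 (frameRatio L H τ T T' hT hT' • y) a)) := by
  rw [ComplexRecordSystem.toFrame_pts_symm_mk]
  rfl

end ComplexToFrame

/-! ## §3 The record system moved to the frame `T'`: SAME models over `L`, AS DATA -/

section RecordToFrame

variable {L : Type} [Field L] [NumberField L] [IsCMField L] {H : Matrix (Fin 3) (Fin 3) L}
  {τ : L →+* ℂ} {T : GL (Fin 3) ℂ} {hT : formCongr (starRingEnd ℂ) T (H.map τ) = BallModel.J}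
  {K₀ : C5.OpenCompactSubgroup ↥(finAdelic (↥(maximalRealSubfield L)) L (IsCMField.complexConj L) 3 H)}
  (T' : GL (Fin 3) ℂ) (hT' : formCongr (starRingEnd ℂ) T' (H.map τ) = BallModel.J)

/-- **(62) in the frame `T'`**, read through `e := Iso.refl` and the points of `R_ℂ.toFrame T'` — the `recip` hypothesis of ✔ `RecordSystem.ofDescent` /
`recordSystem_exists_of_descent` at `(T', R_ℂ.toFrame T', R.M, Iso.refl)`: the point is `(R.pts K)⁻¹ [u • y, aK]`, `u • y` is a line point in the frame `T`,
and `R.recip` applies verbatim. [cite: Milne2005ShimuraVarieties, Def. 12.8 (62) p. 114] [cite: Deligne1979ShimuraVarieties, 2.2.4–2.2.5] -/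
theorem recip_toFrame (R : RecordSystem L H τ T hT K₀) :
    letI : Algebra L ℂ := τ.toAlgebra
    ∀ (K : C5.SmallLevel K₀) (σ : ℂ ≃ₐ[L] ℂ) (s : (FiniteAdeleRing (𝓞 L) L)ˣ),
      IsArtinCorrespondent L τ s σ.toRingEquiv →
      ∀ (v₃ : Fin 3 → L) (x : Ball), IsLinePoint L τ T' v₃ x →
        ∀ d : finAdelic (↥(maximalRealSubfield L)) L (IsCMField.complexConj L) 3 H,
          IsDiagTwist L H v₃ (recipFactor L s) d →
          ∀ a : finAdelic (↥(maximalRealSubfield L)) L (IsCMField.complexConj L) 3 H,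
            σ • (AlgPoints.baseChangeEquiv τ (R.M.obj K)).symm
                (AlgPoints.map ((Iso.refl (R.M ⋙ baseChangeHom τ)).inv.app K)
                  (((ComplexRecordSystem.toFrame T' hT' R.complexRecordSystem).pts K).symm (ShimuraSet.mk L H τ T' hT' K.1.1 x a))) =
              (AlgPoints.baseChangeEquiv τ (R.M.obj K)).symm
                (AlgPoints.map ((Iso.refl (R.M ⋙ baseChangeHom τ)).inv.app K)
                  (((ComplexRecordSystem.toFrame T' hT' R.complexRecordSystem).pts K).symm
                    (ShimuraSet.mk L H τ T' hT' K.1.1 x (d * a)))) := by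
  letI : Algebra L ℂ := τ.toAlgebra
  intro K σ s hs v₃ x hx d hd a
  have hid : ∀ P : ComplexPoints ((baseChangeHom τ).obj (R.M.obj K)),
      AlgPoints.map ((Iso.refl (R.M ⋙ baseChangeHom τ)).inv.app K) P = P := fun P => by
    apply Over.OverMorphism.ext
    rw [AlgPoints.map_apply, Over.comp_left, Iso.refl_inv, NatTrans.id_app, Over.id_left]
    exact Category.comp_id _
  have hP : ∀ b : finAdelic (↥(maximalRealSubfield L)) L (IsCMField.complexConj L) 3 H,
      (AlgPoints.baseChangeEquiv τ (R.M.obj K)).symm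
          (AlgPoints.map ((Iso.refl (R.M ⋙ baseChangeHom τ)).inv.app K)
            (((ComplexRecordSystem.toFrame T' hT' R.complexRecordSystem).pts K).symm (ShimuraSet.mk L H τ T' hT' K.1.1 x b))) =
        (R.pts K).symm (ShimuraSet.mk L H τ T hT K.1.1 (frameRatio L H τ T T' hT hT' • x) b) := by
    intro b
    rw [ComplexRecordSystem.toFrame_pts_symm_mk_record]
    exact (congrArg (AlgPoints.baseChangeEquiv τ (R.M.obj K)).symm (hid _)).trans
      ((AlgPoints.baseChangeEquiv τ (R.M.obj K)).symm_apply_apply _)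
  rw [hP a, hP (d * a)]
  exact R.recip K σ s hs v₃ (frameRatio L H τ T T' hT hT' • x) ((isLinePoint_ofFrames_iff L H τ T T' hT hT' v₃ x).1 hx) d hd a

/-- **The record system IN THE FRAME `T'`, AS DATA, with the SAME models**: ✔ `RecordSystem.ofDescent` at `(R_ℂ.toFrame T', R.M, Iso.refl, recip_toFrame)`.
(The canonical model does not depend on the chosen Sylvester frame of `H^τ`: [Milne2005ShimuraVarieties] §12, the datum being `(G, X)`.)
[cite: Deligne1979ShimuraVarieties, 2.2.5 (PDF p. 29 of Milne's translation)] [cite: Milne2005ShimuraVarieties, §12 and Def. 12.8 (62) p. 114] -/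
def RecordSystem.toFrame (R : RecordSystem L H τ T hT K₀) : RecordSystem L H τ T' hT' K₀ :=
  RecordSystem.ofDescent (ComplexRecordSystem.toFrame T' hT' R.complexRecordSystem) R.M R.smooth R.projective (Iso.refl _)
    (recip_toFrame T' hT' R)

/-- The models of `R.toFrame T' hT'` are `R.M` (by `rfl`). [cite: Deligne1979ShimuraVarieties, 2.2.5] -/
theorem RecordSystem.toFrame_M (R : RecordSystem L H τ T hT K₀) : (RecordSystem.toFrame T' hT' R).M = R.M :=
  rfl

/-- **The points of `R.toFrame T' hT'`**: `((R.toFrame T' hT').pts K)⁻¹ [y, aK]_{T'} = (R.pts K)⁻¹ [u • y, aK]_T`, `u = T⁻¹T'`.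
[cite: Deligne1979ShimuraVarieties, 2.2.5] [cite: Milne2005ShimuraVarieties, Lemma 5.13 p. 57] -/
theorem RecordSystem.toFrame_pts_symm_mk (R : RecordSystem L H τ T hT K₀) (K : C5.SmallLevel K₀) (y : Ball)
    (a : finAdelic (↥(maximalRealSubfield L)) L (IsCMField.complexConj L) 3 H) :
    letI : Algebra L ℂ := τ.toAlgebra
    ((RecordSystem.toFrame T' hT' R).pts K).symm (ShimuraSet.mk L H τ T' hT' K.1.1 y a) =
      (R.pts K).symm (ShimuraSet.mk L H τ T hT K.1.1 (frameRatio L H τ T T' hT hT' • y) a) := by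
  letI : Algebra L ℂ := τ.toAlgebra
  have hid : ∀ P : ComplexPoints ((baseChangeHom τ).obj (R.M.obj K)),
      AlgPoints.map ((Iso.refl (R.M ⋙ baseChangeHom τ)).inv.app K) P = P := fun P => by
    apply Over.OverMorphism.ext
    rw [AlgPoints.map_apply, Over.comp_left, Iso.refl_inv, NatTrans.id_app, Over.id_left]
    exact Category.comp_id _
  unfold RecordSystem.toFrame
  rw [RecordSystem.ofDescent_pts_symm, ComplexRecordSystem.toFrame_pts_symm_mk_record]
  exact (congrArg (AlgPoints.baseChangeEquiv τ (R.M.obj K)).symm (hid _)).trans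
    ((AlgPoints.baseChangeEquiv τ (R.M.obj K)).symm_apply_apply _)

/-- **Change of frame, ∃-form with models**: `∃ R' : RecordSystem L H τ T' hT' K₀, R'.M = R.M` (= ✔ `RecordSystem.exists_of_frame`, now through the data).
[cite: Deligne1979ShimuraVarieties, 2.2.5] -/
theorem RecordSystem.exists_toFrame (R : RecordSystem L H τ T hT K₀) : ∃ R' : RecordSystem L H τ T' hT' K₀, R'.M = R.M :=
  ⟨RecordSystem.toFrame T' hT' R, rfl⟩

end RecordToFrame

end Summit.HodgeConjecture.CorCM.Model.RecordSystemConj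

end
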